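import Mathlib
import Summits.Ventures.PercRepro2.OneTypedEdge
import Summits.Ventures.PercRepro2.TypedSplit
import Summits.Ventures.PercRepro2.TypedUntouched
import Summits.Ventures.PercRepro2.TypedSwapRoots
import Summits.Ventures.PercRepro2.TypedCoincRootEdge
import Summits.Ventures.PercRepro2.TypedTriangleTwo

/-!
# A mark pinned into a root cluster in every copy kills every typed base (blind cell PercRepro2,
night-3 g14, 2026-08-27; `proofs/NIGHT3-CERT.md` §23.2 (ii))

**State level** (`decide`, 32,768 cases each): the `S₃`-symmetrised kernel vanishes on every state
triple in which all three states carry `b ∈ C(a₁)` (`KBsym_eq_zero_of_all_Lb`), or all three carry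
`o ∈ C(a₁)` (`KBsym_eq_zero_of_all_Lo`) — four of the 28 minimal monotone vanishing conditions
(with the mirrors at `a₂`).

**Graph level**: if every configuration of the support of the typed count (the configurations
agreeing with the pinning `z` off `F`) joins `a₁` to `b` — e.g. a pinned-open path from `a₁` to
`b` — the typed base vanishes (`typedCount_eq_zero_of_pinned_b`); likewise for `o`
(`typedCount_eq_zero_of_pinned_o`); mirrors at `a₂`.  (Bernstein reading: when `σ_b` or the
`o`-coordinates are constant on `Q`, the covariance form has no content on that minor.)  Nothing
here asserts anything about the original lane.
-/

namespace Summit.Ventures.PercRepro2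

open UnionCluster

namespace CovForm

namespace PinnedMark

open OneTyped Untouched CoincRoot

section States

/-- All three states carry `b ∈ C(a₁)`: the symmetrised kernel vanishes (32,768 cases). -/
theorem KBsym_eq_zero_of_all_Lb (q Lo Ho L3 H3 q' Lo' Ho' L3' H3' q'' Lo'' Ho'' L3'' H3'' : Bool) :
    KBsym (mkSt q Lo true L3 Ho false H3) (mkSt q' Lo' true L3' Ho' false H3')
      (mkSt q'' Lo'' true L3'' Ho'' false H3'') = 0 := by
  revert q Lo Ho L3 H3 q' Lo' Ho' L3' H3' q'' Lo'' Ho'' L3'' H3''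
  decide +kernel

/-- All three states carry `o ∈ C(a₁)`: the symmetrised kernel vanishes (32,768 cases). -/
theorem KBsym_eq_zero_of_all_Lo (q Lb Hb L3 H3 q' Lb' Hb' L3' H3' q'' Lb'' Hb'' L3'' H3'' : Bool) :
    KBsym (mkSt q true Lb L3 false Hb H3) (mkSt q' true Lb' L3' false Hb' H3')
      (mkSt q'' true Lb'' L3'' false Hb'' H3'') = 0 := by
  revert q Lb Hb L3 H3 q' Lb' Hb' L3' H3' q'' Lb'' Hb'' L3'' H3''
  decide +kernel

end States

section Main

open Classical

variable {V : Type*} {E : Type*} [Fintype E] [DecidableEq E] {R : Type*} [Field R]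
  [LinearOrder R] [IsStrictOrderedRing R]
variable (ends : E → Sym2 V) (o a₁ a₂ a₃ b : V)

omit [Fintype E] [DecidableEq E] [LinearOrder R] [IsStrictOrderedRing R] in
/-- A configuration with `b ∈ C(a₁)` either fails `Q` or has the state `mkSt q L_o true L₃ H_o false H₃`. -/
lemma st_of_Lb (u : Config E) (hb : Conn ends u a₁ b) :
    (st ends o a₁ a₂ a₃ b u).q' = true ∨
      st ends o a₁ a₂ a₃ b u = mkSt false (decide (Conn ends u a₁ o)) true (decide (Conn ends u a₁ a₃))
        (decide (Conn ends u a₂ o)) false (decide (Conn ends u a₂ a₃)) := by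
  by_cases hq : Conn ends u a₂ a₁
  · left
    unfold st St.q'
    exact decide_eq_true hq
  · right
    have hb' : ¬ Conn ends u a₂ b := fun h' => hq (conn_trans h' (conn_symm hb))
    unfold st mkSt
    simp only [hb, hb', decide_true, decide_false, hq]

omit [Fintype E] [DecidableEq E] [LinearOrder R] [IsStrictOrderedRing R] in
/-- A configuration with `o ∈ C(a₁)` either fails `Q` or has the state `mkSt q true L_b L₃ false H_b H₃`. -/
lemma st_of_Lo (u : Config E) (ho : Conn ends u a₁ o) :
    (st ends o a₁ a₂ a₃ b u).q' = true ∨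
      st ends o a₁ a₂ a₃ b u = mkSt false true (decide (Conn ends u a₁ b)) (decide (Conn ends u a₁ a₃))
        false (decide (Conn ends u a₂ b)) (decide (Conn ends u a₂ a₃)) := by
  by_cases hq : Conn ends u a₂ a₁
  · left
    unfold st St.q'
    exact decide_eq_true hq
  · right
    have ho' : ¬ Conn ends u a₂ o := fun h' => hq (conn_trans h' (conn_symm ho))
    unfold st mkSt
    simp only [ho, ho', decide_true, decide_false, hq]

/-- **`b` in the cluster of `a₁` in every configuration of the support: every typed base
vanishes.** -/
theorem typedCount_eq_zero_of_pinned_b (F : Finset E) (z : Config E) (τ : E → ℕ)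
    (hτ : ∀ e ∈ F, τ e = 1 ∨ τ e = 2)
    (hb : ∀ x : Config E, (∀ e, e ∉ F → x e = z e) → Conn ends x a₁ b) :
    typedCount F z τ (K3 ends o a₁ a₂ a₃ b : Config E → Config E → Config E → R) = 0 := by
  have h6 := Triangle.six_mul_typedCount_KBsym'' (R := R) ends o a₁ a₂ a₃ b F z τ hτ
  have hK : typedCount F z τ (fun x y w => ((KBsym (st ends o a₁ a₂ a₃ b x) (st ends o a₁ a₂ a₃ b y)
      (st ends o a₁ a₂ a₃ b w) : ℤ) : R)) = 0 := by
    rw [← typedCount_zero_kernel F z τ]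
    refine typedCount_congr_on_support F z τ fun x y w hxyw _ => ?_
    have hx := hb x fun e he => (hxyw e he).1
    have hy := hb y fun e he => (hxyw e he).2.1
    have hw := hb w fun e he => (hxyw e he).2.2
    rcases st_of_Lb ends o a₁ a₂ a₃ b x hx with hq | hsx
    · rw [KBsym_eq_zero_of_q' _ _ _ (Or.inl hq)]; simp
    rcases st_of_Lb ends o a₁ a₂ a₃ b y hy with hq | hsy
    · rw [KBsym_eq_zero_of_q' _ _ _ (Or.inr (Or.inl hq))]; simp
    rcases st_of_Lb ends o a₁ a₂ a₃ b w hw with hq | hsw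
    · rw [KBsym_eq_zero_of_q' _ _ _ (Or.inr (Or.inr hq))]; simp
    rw [hsx, hsy, hsw, KBsym_eq_zero_of_all_Lb]
    simp
  rw [hK] at h6
  have h6' : (6 : R) ≠ 0 := by norm_num
  exact (mul_eq_zero.mp h6).resolve_left h6'

/-- **`o` in the cluster of `a₁` in every configuration of the support: every typed base
vanishes.** -/
theorem typedCount_eq_zero_of_pinned_o (F : Finset E) (z : Config E) (τ : E → ℕ)
    (hτ : ∀ e ∈ F, τ e = 1 ∨ τ e = 2)
    (ho : ∀ x : Config E, (∀ e, e ∉ F → x e = z e) → Conn ends x a₁ o) :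
    typedCount F z τ (K3 ends o a₁ a₂ a₃ b : Config E → Config E → Config E → R) = 0 := by
  have h6 := Triangle.six_mul_typedCount_KBsym'' (R := R) ends o a₁ a₂ a₃ b F z τ hτ
  have hK : typedCount F z τ (fun x y w => ((KBsym (st ends o a₁ a₂ a₃ b x) (st ends o a₁ a₂ a₃ b y)
      (st ends o a₁ a₂ a₃ b w) : ℤ) : R)) = 0 := by
    rw [← typedCount_zero_kernel F z τ]
    refine typedCount_congr_on_support F z τ fun x y w hxyw _ => ?_
    have hx := ho x fun e he => (hxyw e he).1
    have hy := ho y fun e he => (hxyw e he).2.1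
    have hw := ho w fun e he => (hxyw e he).2.2
    rcases st_of_Lo ends o a₁ a₂ a₃ b x hx with hq | hsx
    · rw [KBsym_eq_zero_of_q' _ _ _ (Or.inl hq)]; simp
    rcases st_of_Lo ends o a₁ a₂ a₃ b y hy with hq | hsy
    · rw [KBsym_eq_zero_of_q' _ _ _ (Or.inr (Or.inl hq))]; simp
    rcases st_of_Lo ends o a₁ a₂ a₃ b w hw with hq | hsw
    · rw [KBsym_eq_zero_of_q' _ _ _ (Or.inr (Or.inr hq))]; simp
    rw [hsx, hsy, hsw, KBsym_eq_zero_of_all_Lo]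
    simp
  rw [hK] at h6
  have h6' : (6 : R) ≠ 0 := by norm_num
  exact (mul_eq_zero.mp h6).resolve_left h6'

/-- The mirror: `b` in the cluster of `a₂` in every configuration of the support. -/
theorem typedCount_eq_zero_of_pinned_b' (F : Finset E) (z : Config E) (τ : E → ℕ)
    (hτ : ∀ e ∈ F, τ e = 1 ∨ τ e = 2)
    (hb : ∀ x : Config E, (∀ e, e ∉ F → x e = z e) → Conn ends x a₂ b) :
    typedCount F z τ (K3 ends o a₁ a₂ a₃ b : Config E → Config E → Config E → R) = 0 := by
  rw [← SwapRoots.typedCount_swap_roots ends o a₁ a₂ a₃ b F z τ]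
  exact typedCount_eq_zero_of_pinned_b ends o a₂ a₁ a₃ b F z τ hτ hb

/-- The mirror: `o` in the cluster of `a₂` in every configuration of the support. -/
theorem typedCount_eq_zero_of_pinned_o' (F : Finset E) (z : Config E) (τ : E → ℕ)
    (hτ : ∀ e ∈ F, τ e = 1 ∨ τ e = 2)
    (ho : ∀ x : Config E, (∀ e, e ∉ F → x e = z e) → Conn ends x a₂ o) :
    typedCount F z τ (K3 ends o a₁ a₂ a₃ b : Config E → Config E → Config E → R) = 0 := by
  rw [← SwapRoots.typedCount_swap_roots ends o a₁ a₂ a₃ b F z τ]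
  exact typedCount_eq_zero_of_pinned_o ends o a₂ a₁ a₃ b F z τ hτ ho

end Main

end PinnedMark

end CovForm

end Summit.Ventures.PercRepro2
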